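import Literature.NumberTheory.GaloisRepresentations.ModPGaloisRep
import HarnessLib

/-!
# Discharge of `fundamentalCharacter_pow`: norm compatibility of Serre's fundamental characters (trunk GalRep, item C15)

D-0014 keeps `Literature/` sorry-free by stating cited results as named facts `def X : Prop`.
This sibling file of `Literature.NumberTheory.GaloisRepresentations.ModPGaloisRep` (next to
`ModPGaloisRepProofs.lean` — the fundamental characters are tame — and
`ModPGaloisRepKummerProofs.lean` — independence of the uniformiser, surjectivity) proves, as
`theorem X_holds : X`, the named fact

* `Literature.NumberTheory.GaloisRepresentations.fundamentalCharacter_pow` —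
  `ψ_m ^ ((q ^ m - 1)/(q - 1)) = ψ_1` for the fundamental characters
  `ψ_m = fundamentalCharacter F m ι ϖ hϖ : I_F →* kˣ` of level `m ≠ 0` of the inertia group of a
  non-archimedean local field `F` with `q = #𝓀[F]`,

as `Literature.NumberTheory.GaloisRepresentations.fundamentalCharacter_pow_holds`; users holding
`(h : fundamentalCharacter_pow F)` are fed this theorem.

## What the source says

Serre, Invent. Math. 15 (1972), §1.3: for `d` prime to `p` and a uniformiser `x` of `K_nr`,
`K_d = K_nr(x^{1/d})`, `s(x^{1/d}) = θ_d(s) x^{1/d}` defines an isomorphism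
`θ_d : Gal(K_d/K_nr) → μ_d`, and "`K_d` et `θ_d` ne dépendent pas du choix de `x`, ni de celui de
sa racine `d`-ième".  Prop. 1: the `θ_d` define `θ : I_t ≃ lim← μ_d`, where "l'homomorphisme de
transition `μ_{dd'} → μ_d` du système projectif `(μ_d)` est `α ↦ α^{d'}`", i.e.
`θ_d = (θ_{dd'})^{d'}`.  Prop. 2: equivalently `θ : I_t ≃ lim← 𝔽_q^*` for the norm maps
`N : 𝔽_{q^m}^* → 𝔽_q^*`, `N(α) = α^{1+q+⋯+q^{m-1}}`.  §1.7: a *fundamental character of level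
`n`* (`q = p^n` there; here `q ^ m` with `q = #𝓀[F]`, as in Serre, Duke Math. J. 54 (1987),
§2.1 for `F = ℚ_p`) is `θ_{q-1}` composed with an embedding of `𝔽_q` into the coefficient
field.  With `d = q - 1`, `dd' = q^m - 1`, `d' = (q^m-1)/(q-1) = 1 + q + ⋯ + q^{m-1}` this is
exactly `ψ_m ^ d' = ψ_1` (both read through the same residue embedding `ι`).  §1 of the paper
has no numbered displayed formulas; the locator "eq. (10)" in the docstring of the fact
designates this transition formula.

## Proof

Put `N = (q^m-1)/(q-1)`, so `N (q-1) = q^m-1` (`Nat.sub_one_dvd_pow_sub_one`).  In this library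
`ψ_m(σ) = ι(σ(z_m)/z_m mod 𝔓)` for the *chosen* root `z_m = kummerRoot` of `z ^ (q^m-1) = ϖ`
(`𝔓 = absMaximalIdeal F`, `S = absIntegers 𝒪[F] F`).  The element `ζ = z_m ^ N / z_1` satisfies
`ζ ^ (q-1) = ϖ/ϖ = 1`, hence is integral (lies in `S`) and is a unit of `S`.  For `σ ∈ I_F` one
has in `S` the identity `(σ z_m / z_m) ^ N · ζ = σ(ζ) · (σ z_1 / z_1)` (both sides are
`σ(z_m) ^ N / z_1`), and `σ(ζ) ≡ ζ (mod 𝔓)` because `I_F` is Mathlib's `Ideal.inertia` of `𝔓`;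
cancelling the unit `ζ mod 𝔓` in `S ⧸ 𝔓` gives `(σ z_m/z_m)^N ≡ σ z_1/z_1 (mod 𝔓)`, and applying
`ι` gives the claim.  This is the argument of Serre's independence remark (§1.3) for the two
`(q-1)`-th roots `z_m ^ N` and `z_1` of `ϖ`, as in `kummerCharacter_eq_of_associated_holds`
(file `ModPGaloisRepKummerProofs`).  Only Mathlib and the (sorry-free) definitions of
`ModPGaloisRep` are used; in particular neither the maximality of `𝔓` nor any henselian named
fact of item C4 is needed.  No definition and no new named fact is introduced (D-0026).

## References

* [SerreInventiones1972] J.-P. Serre, *Propriétés galoisiennes des points d'ordre fini des courbes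
  elliptiques*, Invent. Math. 15 (1972), 259–331, §1.3 (θ_d; Prop. 1: transition maps
  `α ↦ α^{d'}`; Prop. 2: norms `N(α) = α^{1+q+⋯+q^{m-1}}`), §1.7 (caractères fondamentaux de
  niveau `n`).  Read in: J.-P. Serre, *Œuvres – Collected Papers* III, no. 94.
* [Serre1987] J.-P. Serre, Duke Math. J. 54 (1987), §2.1 (characters of `I_t` of level 1 and 2).
-/

noncomputable section

open scoped Valued
open Field ValuativeRel

namespace Literature.NumberTheory.GaloisRepresentations

open GaloisRepresentations.IsNonarchimedeanLocalField

universe u v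

variable (F : Type u) [Field F] [ValuativeRel F] [TopologicalSpace F] [IsNonarchimedeanLocalField F]
variable {k : Type v} [Field k]

/-- **Discharge of `Literature.NumberTheory.GaloisRepresentations.fundamentalCharacter_pow`** (norm compatibility of the fundamental
characters, item C15): `ψ_m ^ ((q ^ m - 1)/(q - 1)) = ψ_1` for `m ≠ 0`.

Serre states this as the description of the transition maps of the projective system computing
the tame inertia: `θ : I_t ≃ lim← μ_d`, where "l'homomorphisme de transition `μ_{dd'} → μ_d` du
système projectif `(μ_d)` est `α ↦ α^{d'}`" (§1.3, Prop. 1), equivalently `I_t ≃ lim← 𝔽_q^*`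
for the norm maps "`N : 𝔽_{q^m}^* → 𝔽_q^*`, `N(α) = α^{1+q+⋯+q^{m-1}}`" (§1.3, Prop. 2), i.e.
`θ_{q-1} = (θ_{q^m-1})^{(q^m-1)/(q-1)}`; a fundamental character of level `m` is `θ_{q^m-1}`
composed with an embedding of `𝔽_{q^m}` into `k` (§1.7, "caractères fondamentaux de niveau `n`"),
here `ι ∘ (mod 𝔓)`.  (§1 of the source has no numbered displays; the locator "eq. (10)" in the
docstring of the fact designates this transition formula.)

Proof.  Put `N = (q^m-1)/(q-1)`, so `N (q-1) = q^m-1` (`Nat.sub_one_dvd_pow_sub_one`).  With the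
chosen roots `z_m ^ (q^m-1) = ϖ` and `z_1 ^ (q-1) = ϖ` (`kummerRoot`), `ζ = z_m ^ N / z_1`
satisfies `ζ ^ (q-1) = 1`, so `ζ` lies in `S = absIntegers 𝒪[F] F` and is a unit there.  For
`σ ∈ I_F` the Kummer cocycles satisfy, in `S`,
`(σ z_m / z_m) ^ N · ζ = σ(ζ) · (σ z_1 / z_1)` (both sides equal `σ(z_m) ^ N / z_1`), and
`σ(ζ) ≡ ζ (mod 𝔓)` by the definition of the inertia group `I_F = I(𝔓)` (Mathlib
`Ideal.inertia`); cancelling the unit `ζ mod 𝔓` gives `(σ z_m / z_m) ^ N ≡ σ z_1 / z_1 (mod 𝔓)`,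
which is the claim after applying `ι`.  This is Serre's remark that `θ_d` "ne dépend pas du
choix de `x`, ni de celui de sa racine `d`-ième" (§1.3) applied to the two `(q-1)`-th roots
`z_m ^ N`, `z_1` of `ϖ`.  Only Mathlib and the definitions of `ModPGaloisRep` are used (in
particular not the maximality of `𝔓`).
[cite: SerreInventiones1972, §1.3 Prop. 1 (transition maps `α ↦ α^{d'}`) and Prop. 2
(`N(α) = α^{1+q+⋯+q^{m-1}}`); §1.7 (caractères fondamentaux de niveau n)] -/
theorem fundamentalCharacter_pow_holds : fundamentalCharacter_pow F (k := k) := by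
  intro m hm ι ϖ hϖ
  have hn : 0 < residueFieldCard F ^ m - 1 := residueFieldCard_pow_sub_one_pos F hm
  have h1 : 0 < residueFieldCard F ^ 1 - 1 := residueFieldCard_pow_sub_one_pos F one_ne_zero
  have hq1 : 0 < residueFieldCard F - 1 := Nat.sub_pos_of_lt (one_lt_residueFieldCard F)
  -- `N (q - 1) = q ^ m - 1`
  set N := (residueFieldCard F ^ m - 1) / (residueFieldCard F - 1) with hN
  have hNq : N * (residueFieldCard F - 1) = residueFieldCard F ^ m - 1 :=
    Nat.div_mul_cancel (Nat.sub_one_dvd_pow_sub_one (residueFieldCard F) m)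
  rw [fundamentalCharacter_of_ne_zero F hm, fundamentalCharacter_of_ne_zero F one_ne_zero]
  set zm : AlgebraicClosure F := (kummerRoot F hn ϖ : AlgebraicClosure F) with hzm
  set z1 : AlgebraicClosure F := (kummerRoot F h1 ϖ : AlgebraicClosure F) with hz1
  have hzm0 : zm ≠ 0 := coe_kummerRoot_ne_zero hn hϖ.ne_zero
  have hz10 : z1 ≠ 0 := coe_kummerRoot_ne_zero h1 hϖ.ne_zero
  -- `z1 ^ (q - 1) = ϖ = zm ^ (q ^ m - 1)`
  have hz1pow : z1 ^ (residueFieldCard F - 1) = algebraMap 𝒪[F] (AlgebraicClosure F) ϖ := by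
    rw [hz1]
    convert coe_kummerRoot_pow F h1 ϖ using 2
    rw [pow_one]
  -- `ζ = zm ^ N / z1` is a `(q - 1)`-th root of unity, hence a unit `W` of `S`
  have hζpow : (zm ^ N / z1) ^ (residueFieldCard F - 1) = 1 := by
    rw [div_pow, ← pow_mul, hNq, hzm, coe_kummerRoot_pow, hz1pow, div_self]
    rw [← hz1pow]
    exact pow_ne_zero _ hz10
  have hζint : IsIntegral 𝒪[F] (zm ^ N / z1) :=
    IsIntegral.of_pow hq1 (by rw [hζpow]; exact isIntegral_one)
  set W : absIntegers 𝒪[F] F := ⟨zm ^ N / z1, hζint⟩ with hW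
  have hWu : IsUnit W := by
    rw [← isUnit_pow_iff hq1.ne']
    have h : W ^ (residueFieldCard F - 1) = 1 := Subtype.ext hζpow
    rw [h]
    exact isUnit_one
  ext σ
  rw [MonoidHom.pow_apply, Units.val_pow_eq_pow_val, coe_kummerCharacter_apply,
    coe_kummerCharacter_apply, ← map_pow, ← map_pow]
  congr 1
  -- `σ ∈ I_F` fixes `W` modulo `𝔓`
  have hσW : Ideal.Quotient.mk (absMaximalIdeal F) ((σ : absoluteGaloisGroup F) • W) =
      Ideal.Quotient.mk (absMaximalIdeal F) W :=
    Ideal.Quotient.eq.mpr (σ.2 W)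
  -- `(σ zm / zm) ^ N · W = σ(W) · (σ z1 / z1)` in `S` (both sides are `σ(zm) ^ N / z1`)
  have key : kummerCocycleInt F hn hϖ.ne_zero σ ^ N * W =
      (σ : absoluteGaloisGroup F) • W * kummerCocycleInt F h1 hϖ.ne_zero σ := by
    refine Subtype.ext ?_
    have hσz10 : (σ : absoluteGaloisGroup F) • z1 ≠ 0 := by
      rw [absoluteGaloisGroup.smul_def]; exact (map_ne_zero _).mpr hz10
    have hzmN : zm ^ N ≠ 0 := pow_ne_zero _ hzm0
    simp only [Subalgebra.coe_mul, SubmonoidClass.coe_pow, integralClosure.coe_smul,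
      coe_kummerCocycleInt, kummerCocycle, hW]
    rw [← hzm, ← hz1]
    simp only [absoluteGaloisGroup.smul_def, map_div₀, map_pow, div_pow] at hσz10 ⊢
    rw [div_mul_div_cancel₀ hzmN, div_mul_div_cancel₀ hσz10]
  have hkey := congrArg (Ideal.Quotient.mk (absMaximalIdeal F)) key
  rw [map_mul, map_mul, hσW, mul_comm (Ideal.Quotient.mk (absMaximalIdeal F) W)] at hkey
  exact (hWu.map (Ideal.Quotient.mk (absMaximalIdeal F))).mul_right_cancel hkey

end Literature.NumberTheory.GaloisRepresentations
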